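import Summits.HodgeConjecture.HodgeConjecture.Theorems.SixfoldTableXCensusQuarticMixedAllMembers
import Literature.AlgebraicGeometry.HodgeTheory.CMFieldExistsMixedPlace
import HarnessLib

/-!
# TABLE X (dimension 6) — row 10 `g6.IV(2,1)` (`End⁰ = E` a QUARTIC CM field, `dim_E H¹ = 3`), ALL MEMBERS NOT OF WEIL TYPE:
# the row's kernel verdict with the geometric no-Weil-type datum `hnW` as the ONLY displayed hypothesis
# — cell `pub-hodgeav-hg6`, req-37 (A) Q2b, eng-5 g7

HONEST FRAMING. HC, `HC_AV` (stmt-1333), `HC_CM` (stmt-3052) and the rung H2 are NOT proved and do not occur here. The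
census nodes X2 / X1 of `SixfoldTableXCover` are OURS (`@[conjecture]`), never asserted; here they are DISCHARGED on one
isogeny class per hypothesis set. KERNEL ONLY: the wrapper `census_row10_quartic_of_mixedPlace` (dispatching the CM patterns
`(3,0)+(2,1)` — unconditional — and `(2,1)+(2,1)` / `(2,1)+(1,2)` — under `hnW`) with its member datum «a mixed place»
DISCHARGED by `AbelianVariety.exists_eigenMultiplicity_ne_zero_of_cmField` (Deligne LNM 900 I Ex. 3.7: all places
`Θ`-scalar would make `Lie Hg ⊆ E` abelian, contradicting the irreducibility of the `E`-eigenspaces for `dim_ℚ End⁰ = [E:ℚ]`);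
no definition, no `sorry`, no named fact; nothing restated. The member data are now EXACTLY the row: `B` simple, `dim B = 6`,
`dim_ℚ End⁰(B) = 4`, `φ ∈ End(B)` with colours `μ : Fin 2 → ℂ` (injective, none conjugate to another or itself) of pair
multiplicity `3` (so `E = End⁰(B) = ℚ(φ)` is a quartic CM field with `dim_E H¹ = 3`), and the geometric no-Weil-type datum `hnW`
(«`eigenMultiplicity B β (i√d) ≠ eigenMultiplicity B β (−i√d)` for every `β ∈ End(B)` with `β ≫ β = −d`, `d > 0`» — the
Weil-type members are TABLE X row 11).
* `census_row10_quartic_of_notWeilType` — domain membership ∧ X2-at-`A` ∧ X1-at-`A` at every `A ∼ B`.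
* `hodgeConjectureFor_of_isIsogenous_row10_quartic_of_notWeilType` — L6's CONCLUSION `HodgeConjectureFor` on the whole
  isogeny class.
HC / HC_AV are NOT proved beyond these statements' own content; typed ≠ proved.
-/

set_option linter.dupNamespace false

noncomputable section

open scoped TensorProduct
open CategoryTheory
open Literature.AlgebraicGeometry Literature.AlgebraicGeometry.Motives
open Literature.AlgebraicGeometry.Motives.AbelianVariety (IsIsogenous IsSimple)
open Literature.AlgebraicGeometry.HodgeTheory
open Literature.AlgebraicGeometry.Milne1999
open Literature.AlgebraicTopology.SingularHomology
open Literature.Barriers.HodgeConjecture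
open Summit.HodgeConjecture.HodgeConjecture.Ring2.ClassTargets
open Summit.HodgeConjecture.HodgeConjecture.Ring2.Motiv (ProdCMCell)
open Summit.HodgeConjecture.HodgeConjecture.Ring2.Atlas (IsQuarticFieldTypeIVFourfold)
open Summit.HodgeConjecture.HodgeConjecture.TableX.SimpleRows

namespace Summit.HodgeConjecture.HodgeConjecture.TableX.TypeIVRows

/-- **TABLE X ROW 10 `g6.IV(2,1)`, ALL MEMBERS NOT OF WEIL TYPE — KERNEL VERDICT on the whole isogeny class, `hnW` the only
displayed hypothesis** (`census_row10_quartic_of_mixedPlace` with the mixed place supplied by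
`AbelianVariety.exists_eigenMultiplicity_ne_zero_of_cmField`). HC ∕ HC_AV NOT proved; X2 ∕ X1 stay `@[conjecture]` globally.
[cite: MoonenZarhin1999LowDim, §1 (1.8), §2 (2.3) and §5 (5.1)] [cite: Ribet1983, Thm. 0] [cite: Deligne1982HodgeCycles, I §3 Ex. 3.7]
[cite: vanGeemen1994HodgeAV, Lemma 3.7] [cite: MumfordAV1970, §19 Cor. 2 of Thm. 1 (p. 174)] -/
theorem census_row10_quartic_of_notWeilType {A B : AbelianVariety ℂ} (hB : B.dim = 6) (hBs : B.IsSimple) (φ : B ⟶ B)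
    (hE4 : Module.finrank ℚ B.endAlgebra = 4) (μ : Fin 2 → ℂ) (hinj : Function.Injective μ)
    (hdist : ∀ k k', μ k' ≠ starRingEnd ℂ (μ k))
    (hmult : ∀ k, eigenMultiplicity B φ (μ k) + eigenMultiplicity B φ (starRingEnd ℂ (μ k)) = 3)
    (hnW : ∀ (d : ℕ) (β : B ⟶ B), 0 < d → β ≫ β = -(d • 𝟙 B) →
      eigenMultiplicity B β (Complex.I * (Real.sqrt d : ℂ)) ≠ eigenMultiplicity B β (-(Complex.I * (Real.sqrt d : ℂ))))
    (hAB : IsIsogenous A B) :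
    (A.dim = 6 ∧ ¬ (IsOfCMType A ∨ ProdCMCell IsQuarticFieldTypeIVFourfold (fun Z ↦ Z.dim = 2) A)) ∧
    (∀ c : complexBetti A.X (2 * 2), IsRationalClass c → IsOfHodgeType A.dim A.X (2 * 2) 2 2 c →
      c ∈ divisorClassesSpan A.X A.dim 2 ⊔ Submodule.span ℂ {w' : complexBetti A.X (2 * 2) |
        ∃ (C : AbelianVariety ℂ) (g : A.X ⟶ C.X) (w : complexBetti C.X (2 * 2)), C.dim < A.dim ∧
          IsRationalClass w ∧ IsOfHodgeType C.dim C.X (2 * 2) 2 2 w ∧ w' = complexBetti.map g (2 * 2) w}) ∧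
    (∀ c : complexBetti A.X (2 * 3), IsRationalClass c → IsOfHodgeType A.dim A.X (2 * 3) 3 3 c →
      c ∈ divisorClassesSpan A.X A.dim 3 ⊔ Submodule.span ℂ {w' : complexBetti A.X (2 * 3) |
          ∃ (a : complexBetti A.X (2 * 2)) (b : complexBetti A.X (2 * 1)),
            IsRationalClass a ∧ IsOfHodgeType A.dim A.X (2 * 2) 2 2 a ∧ IsRationalClass b ∧
            IsOfHodgeType A.dim A.X (2 * 1) 1 1 b ∧ w' = cupProduct (two_mul_add_two_mul 2 1) a b} ⊔
        Submodule.span ℂ {w' : complexBetti A.X (2 * 3) |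
          ∃ (C : AbelianVariety ℂ) (g : A.X ⟶ C.X) (w : complexBetti C.X (2 * 3)), C.dim < A.dim ∧
            IsRationalClass w ∧ IsOfHodgeType C.dim C.X (2 * 3) 3 3 w ∧ w' = complexBetti.map g (2 * 3) w} ⊔
        Submodule.span ℂ {w' : complexBetti A.X (2 * 3) |
          ∃ (B' : AbelianVariety ℂ) (g : A.X ⟶ B'.X) (d : ℕ) (ψ : B' ⟶ B') (w : complexBetti B'.X (2 * 3)),
            B'.dim = 6 ∧ 0 < d ∧ ψ ≫ ψ = -(d • 𝟙 B') ∧ IsRationalClass w ∧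
            IsOfHodgeType B'.dim B'.X (2 * 3) 3 3 w ∧ w ∈ weilClassesOf B' ψ 3 d ∧
            w' = complexBetti.map g (2 * 3) w}) := by
  haveI : HodgeTensorFacts.{0, 0} := hodgeTensorFacts_holds.{0, 0}
  obtain ⟨k₁, hk₁⟩ := AbelianVariety.exists_eigenMultiplicity_ne_zero_of_cmField B φ (by rw [hE4, Fintype.card_fin]) μ
    hinj hdist (by norm_num) hmult (by rw [hB, Fintype.card_fin]) 0
  exact census_row10_quartic_of_mixedPlace hB hBs φ hE4 μ hinj hdist hmult k₁ hk₁ hnW hAB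

/-- **L6's CONCLUSION on the isogeny class: the Hodge conjecture holds for every complex abelian variety isogenous to a SIMPLE
sixfold `B` with `dim_ℚ End⁰(B) = 4`, `φ ∈ End(B)` of pair multiplicity `3` (so `End⁰(B)` is a quartic CM field with
`dim_E H¹ = 3`) and `B` not of Weil type relative to any `β ∈ End(B)` with `β ≫ β = −d`, `d > 0`** — the row-10 all-members HC
statement of the cell with `hnW` the only displayed hypothesis (class-defining member data, read off `End(B)`). None of
Markman₄ / Markman₆ / R-W6 / X2 / X1 / `HC_CM` enters. HC ∕ HC_AV NOT proved beyond this statement's own content.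
[cite: MoonenZarhin1999LowDim, §1 (1.7)–(1.8) and §2 (2.3)] [cite: Ribet1983, Thm. 0] [cite: Deligne1982HodgeCycles, I §3 Ex. 3.7]
[cite: vanGeemen1994HodgeAV, §2.4 and Lemma 3.7] -/
theorem hodgeConjectureFor_of_isIsogenous_row10_quartic_of_notWeilType {A B : AbelianVariety ℂ} (hB : B.dim = 6)
    (hBs : B.IsSimple) (φ : B ⟶ B) (hE4 : Module.finrank ℚ B.endAlgebra = 4) (μ : Fin 2 → ℂ)
    (hinj : Function.Injective μ) (hdist : ∀ k k', μ k' ≠ starRingEnd ℂ (μ k))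
    (hmult : ∀ k, eigenMultiplicity B φ (μ k) + eigenMultiplicity B φ (starRingEnd ℂ (μ k)) = 3)
    (hnW : ∀ (d : ℕ) (β : B ⟶ B), 0 < d → β ≫ β = -(d • 𝟙 B) →
      eigenMultiplicity B β (Complex.I * (Real.sqrt d : ℂ)) ≠ eigenMultiplicity B β (-(Complex.I * (Real.sqrt d : ℂ))))
    (hAB : IsIsogenous A B) : HodgeConjectureFor A.dim A.X := by
  haveI : HodgeTensorFacts.{0, 0} := hodgeTensorFacts_holds.{0, 0}
  obtain ⟨k₁, hk₁⟩ := AbelianVariety.exists_eigenMultiplicity_ne_zero_of_cmField B φ (by rw [hE4, Fintype.card_fin]) μ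
    hinj hdist (by norm_num) hmult (by rw [hB, Fintype.card_fin]) 0
  exact hodgeConjectureFor_of_isIsogenous_row10_quartic_of_mixedPlace hB hBs φ hE4 μ hinj hdist hmult k₁ hk₁ hnW hAB

end Summit.HodgeConjecture.HodgeConjecture.TableX.TypeIVRows

end
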